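import Literature.MathematicalPhysics.QuantumFieldTheory.Balaban1983to89.B1Eq324BenfattoKernelSect5HlCumulants
import Literature.MathematicalPhysics.QuantumFieldTheory.Balaban1983to89.B1Eq324BenfattoKernelSect5FreePerturb
import Literature.MathematicalPhysics.QuantumFieldTheory.Balaban1983to89.B1Eq324BenfattoKernelSect5TupleClusters
import Literature.MathematicalPhysics.QuantumFieldTheory.Balaban1983to89.B1Eq324BenfattoSect5IdErrBounds
import HarnessLib

/-!
# `Balaban1983to89.B1Eq324BenfattoKernelSect5IdErrBounds` — [BenfattoEtAl1978] §5 pp. 155–159: THE DISPLAYED CORRECTION TERMS OF THE IDENTIFICATION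
# (`…KernelSect5Identification`) BOUNDED UNDER THE REFERENCE GAUSSIAN `𝒩(0,K)` OF A GENERAL KERNEL — (5.11) + (5.24) inside the cumulants for «H_J vs X»,
# (5.33)–(5.34) for «H_{Γ̄₁} vs Y», Appendix D for the within-box (5.29)-type colourings; rows `K(y,y) ≤ c₀`, `|K(x,y)| ≤ K₀e^{−δ₀ℓ¹(x,y)}` displayed

statement-level skeleton of published theorems with citation tags; proofs where landed; nothing here is a claim about the
Yang–Mills mass gap

WHY THIS MODULE (cell `pub-ymgap`, seat `dag-n08-c` gen 31; node N08 [Balaban1985UV3]; the [BenfattoEtAl1978] source chain behind the (α)-row `h324`;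
the ASSEMBLY layer over the class chain — structural S8 of `N08-PORT-MAP-STRUCTURAL-SIDE.md`).  The concrete `…Sect5IdErrBounds` bounds the four
correction terms of `…Sect5Identification.identification_lower` under the free field `P̂₀` from seat n08-b's `…Sect5HlCumulants` / `…Sect5Psi3Cumulants`
/ `…Sect5Eq534Cumulants` and the Appendix-D bound of `…Sect5TupleClusters`.  Their kernel editions are all in the tree — n08-b's
`…KernelSect5HlCumulants.abs_truncatedExp_kernel_hamiltonian_sub_hatH_le` (p616244), `…KernelSect5FreePerturb.abs_cumulantOf_kernel_add_{psi3,corr,remainder}_sub_le`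
(p615969), this seat's `…KernelSect5TupleClusters.abs_ursellOf_tupleSums_shift_le_exp_of_separated` (p615016) — with the free field's `(hα, hβ, hd)` replaced by
the rows `hK : IsPosSemidefKernel K`, `hdiag : ∀ y, K y y ≤ c₀`, `hK₀ : 1 ≤ K₀`, `hdec : |K(x,y)| ≤ K₀e^{−δ₀ℓ¹(x,y)}` and `max 1 C₀₀ ↦ K₀`,
`log((2d+α²)/2d) ↦ δ₀`.  This file is the same token map of the concrete module's four bounds (the measure-free class bookkeeping —
`tupleSum_sdiff_eq`, `X_eq_tupleSum`, `hatH_eq_X_add_psi3Sum`, `hamiltonian_corridorsBar_eq_tupleSum_add_rem`, `Y_eq_tupleSum`, `corrClass_subset_hatTuplesBar`,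
`slot_eq_tupleSum`, `latticeSumConst_nonneg` — and `…Sect5PerBoxAtPavement.weightedMass_classes_le` are used BY NAME); the within-box colourings are read
under `𝒩(0,K)` = the shifted field at `u = 0` (`map_zero_shift_eq`).

WHAT IS PROVED (theorems only; no definition, no named fact, no `sorry`; axioms standard).
* `map_zero_shift_eq` (`(μ_K).map (0 + ·) = μ_K`), ★ `abs_truncatedExp_hamiltonian_sub_X_le`, ★ `abs_truncatedExp_corridorsBar_sub_Y_le`, ★ `abs_W29_le`,
  ★ `abs_sum_W29_le` — the four displayed terms of `…KernelSect5Identification.identification_lower`'s `idErr` bounded, extensive and exponentially small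
  in the corridor widths, constants as in the concrete module with `K₀`, `δ₀` displayed.

HONEST SCOPE / NOT HERE.  The ledger and the knit are NOT here; one self-located piece of an UNCOMMISSIONED port (plan g81 (II), START-LIST v11 §n08) —
nothing chained; no generalised Basic Lemma is stated; nothing of [Balaban1985UV3] is asserted; count-neutral for N08; nothing about d = 4, the
continuum, OS axioms, a mass gap or the Clay problem.
-/

noncomputable section

open MeasureTheory ProbabilityTheory Finset
open scoped BigOperators Nat NNReal

namespace Literature.MathematicalPhysics.QuantumFieldTheory.Balaban1983to89.B1Eq324BenfattoKernelSect5IdErrBounds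

open _root_.MeasureTheory _root_.ProbabilityTheory
open Literature.Probability.LatticeModels (setPartitions ursellOf cumulantOf)
open Literature.MathematicalPhysics.QuantumFieldTheory
open Literature.MathematicalPhysics.QuantumFieldTheory.Balaban1983to89.B1Eq324BenfattoLemma
open Literature.MathematicalPhysics.QuantumFieldTheory.Balaban1983to89.B1Eq324BenfattoSect5Boxes
open Literature.MathematicalPhysics.QuantumFieldTheory.Balaban1983to89.B1Eq324BenfattoSect5Eq511
open Literature.MathematicalPhysics.QuantumFieldTheory.Balaban1983to89.B1Eq324BenfattoSect5Eq524
open Literature.MathematicalPhysics.QuantumFieldTheory.Balaban1983to89.B1Eq324BenfattoSect5Eq534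
open Literature.MathematicalPhysics.QuantumFieldTheory.Balaban1983to89.B1Eq324BenfattoKernelSect5HlCumulants
  (abs_truncatedExp_kernel_hamiltonian_sub_hatH_le)
open Literature.MathematicalPhysics.QuantumFieldTheory.Balaban1983to89.B1Eq324BenfattoKernelSect5FreePerturb
  (abs_cumulantOf_kernel_add_psi3_sub_le abs_cumulantOf_kernel_add_corr_sub_le abs_cumulantOf_kernel_add_remainder_sub_le)
open Literature.MathematicalPhysics.QuantumFieldTheory.Balaban1983to89.B1Eq324BenfattoKernelSect5TupleClusters
  (abs_ursellOf_tupleSums_shift_le_exp_of_separated)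
open Literature.MathematicalPhysics.QuantumFieldTheory.Balaban1983to89.B1Eq324BenfattoSect5IdErrBounds
  (tupleSum_sdiff_eq truncatedExp_congr latticeSumConst_nonneg psi3Class_subset_hatTuples X_eq_tupleSum hatH_eq_X_add_psi3Sum
   corrClass_subset_hatTuplesBar hamiltonian_corridorsBar_eq_tupleSum_add_rem Y_eq_tupleSum slot_eq_tupleSum)
open Literature.MathematicalPhysics.QuantumFieldTheory.Balaban1983to89.B1Eq324BenfattoSect5LegGeometry
  (le_l1_core_sdiff_frame4_of_not_mem_core not_mem_core_of_mem_frame1_union_frame2)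
open Literature.MathematicalPhysics.QuantumFieldTheory.Balaban1983to89.B1Eq324BenfattoSect5PerBoxAtPavement
  (classes_subset_box weightedMass_classes_le)

variable {d : ℕ} {K : B1Eq324BenfattoLemma.Site d → B1Eq324BenfattoLemma.Site d → ℝ}

/-! ## §0  The centred field as the shifted field at `u = 0` -/

/-- `𝒩(0,K)` is its own push-forward under the shift by the zero configuration (`0 + ζ = ζ`). [folklore]
[cite: BenfattoEtAl1978, Appendix C 2) p.164 (centre `u = 0`)] -/
theorem map_zero_shift_eq (K : B1Eq324BenfattoLemma.Site d → B1Eq324BenfattoLemma.Site d → ℝ) :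
    (gaussianFieldOfKernel K).map
        (fun (ζ : B1Eq324BenfattoLemma.Site d → ℝ) (y : B1Eq324BenfattoLemma.Site d) => (fun _ => (0 : ℝ)) y + ζ y) =
      gaussianFieldOfKernel K := by
  have h : (fun (ζ : B1Eq324BenfattoLemma.Site d → ℝ) (y : B1Eq324BenfattoLemma.Site d) => (fun _ => (0 : ℝ)) y + ζ y) = id := by
    funext ζ y
    simp
  rw [h, Measure.map_id]

/-! ## §1  «H_J vs X» under `𝒩(0,K)` -/

section HX

variable {s D : ℕ} {κ : ℝ} {a : Coef d} {J : Finset (B1Eq324BenfattoLemma.Site d)} {L w v : ℕ}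
  {B : Finset (B1Eq324BenfattoLemma.Site d)}

/-- **«H_J vs X» — (5.11) AND (5.24) INSIDE THE FREE CUMULANTS**: for every order `k+1`,
`|Ê₀^T(H_J;k+1) − Ê₀^T(X;k+1)| ≤ [(5.11) in cumulants: …HlCumulants] + [Ψ₃-removal: …Psi3Cumulants at T_X := hatTuples ∖ Ψ₃cls]` — both EXTENSIVE
(`∝ |J|` resp. `∝ |B|·L^d`) and exponentially small in the corridor widths (`e^{−(c/2)w}`, `e^{−(c/2)v}`, `c = ϰ/2 − (δ/2)D²√d`).
[cite: BenfattoEtAl1978, (5.11) p.155, (5.24) p.157, (5.31)–(5.35) pp.158–159] -/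
theorem abs_truncatedExp_hamiltonian_sub_X_le (hK : IsPosSemidefKernel K) {c₀ : ℝ≥0} (hdiag : ∀ y, K y y ≤ c₀)
    {K₀ δ₀ : ℝ} (hK₀ : 1 ≤ K₀)
    (hdec : ∀ x y : B1Eq324BenfattoLemma.Site d, |K x y| ≤ K₀ * Real.exp (-(δ₀ * ∑ jj, |((x jj : ℝ) - (y jj : ℝ))|)))
    (hJ : CoefSupportedIn a J) {A : ℝ}
    (hA0 : 0 ≤ A) (hA : ∀ (p : ℕ) (Δ : Fin p → B1Eq324BenfattoLemma.Site d) (n : Fin p → ℕ), |a p Δ n| ≤ A)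
    (hL : 0 < L) (hB : J.image (boxIndex L) ⊆ B) (hv : v ≤ w) {δ : ℝ} (hδ : 0 < δ) (hδle : δ ≤ δ₀)
    (hres : 0 < κ / 2 - δ / 2 * ((D : ℝ) ^ 2 * Real.sqrt d)) (k : ℕ) :
    |truncatedExp (gaussianFieldOfKernel K) (hamiltonian s D κ a J) (k + 1)
        - truncatedExp (gaussianFieldOfKernel K)
            (fun z => hamiltonian s D κ a (corridors L w B) z + ∑ m ∈ B, (psi1 s D κ a L w v m z + psi2 s D κ a L w m z)) (k + 1)| ≤
      2 ^ (k + 1) * (2 ^ ((k + 1) * D) * 2 ^ 2 ^ ((k + 1) * D) * K₀ ^ ((k + 1) * D)) *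
          ((A * Real.exp (δ / 2 * ((D : ℝ) ^ 2 * d)) *
              Real.exp (-((κ / 2 - δ / 2 * ((D : ℝ) ^ 2 * Real.sqrt d)) / 2 * w))) * J.card *
            ∑ p ∈ Finset.Icc 1 s, ((admissible p D).card : ℝ) *
              ((2 / (1 - Real.exp (-((κ / 2 - δ / 2 * ((D : ℝ) ^ 2 * Real.sqrt d)) / 2 / (p : ℕ) / Real.sqrt d))) *
                Real.exp ((κ / 2 - δ / 2 * ((D : ℝ) ^ 2 * Real.sqrt d)) / 2 / (p : ℕ) / Real.sqrt d)) ^ d) ^ (p - 1)) *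
          (A * Real.exp (δ / 2 * ((D : ℝ) ^ 2 * d)) *
            ((1 : ℝ) * (2 / (1 - Real.exp (-(δ / (2 * ((k + 1 : ℕ) : ℝ)) / Real.sqrt d))) *
              Real.exp (δ / (2 * ((k + 1 : ℕ) : ℝ)) / Real.sqrt d)) ^ d) *
            ∑ p ∈ Finset.Icc 1 s, ((admissible p D).card : ℝ) *
              ((2 / (1 - Real.exp (-((κ / 2 - δ / 2 * ((D : ℝ) ^ 2 * Real.sqrt d)) / (p : ℕ) / Real.sqrt d))) *
                Real.exp ((κ / 2 - δ / 2 * ((D : ℝ) ^ 2 * Real.sqrt d)) / (p : ℕ) / Real.sqrt d)) ^ d) ^ (p - 1)) ^ k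
      + 2 ^ (k + 1) * (2 ^ ((k + 1) * D) * 2 ^ 2 ^ ((k + 1) * D) * K₀ ^ ((k + 1) * D)) *
        (B.card * (A * Real.exp (δ / 2 * ((D : ℝ) ^ 2 * d)) * Real.exp (-((κ / 2 - δ / 2 * ((D : ℝ) ^ 2 * Real.sqrt d)) / 2 * v)) *
          (L : ℝ) ^ d * ∑ p ∈ Finset.Icc 1 s, ((admissible p D).card : ℝ) *
            ((2 / (1 - Real.exp (-((κ / 2 - δ / 2 * ((D : ℝ) ^ 2 * Real.sqrt d)) / 2 / (p : ℕ) / Real.sqrt d))) *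
              Real.exp ((κ / 2 - δ / 2 * ((D : ℝ) ^ 2 * Real.sqrt d)) / 2 / (p : ℕ) / Real.sqrt d)) ^ d) ^ (p - 1))) *
        (A * Real.exp (δ / 2 * ((D : ℝ) ^ 2 * d)) *
          (2 / (1 - Real.exp (-(δ / (2 * ((k + 1 : ℕ) : ℝ)) / Real.sqrt d))) * Real.exp (δ / (2 * ((k + 1 : ℕ) : ℝ)) / Real.sqrt d)) ^ d *
          ∑ p ∈ Finset.Icc 1 s, ((admissible p D).card : ℝ) *
            ((2 / (1 - Real.exp (-((κ / 2 - δ / 2 * ((D : ℝ) ^ 2 * Real.sqrt d)) / (p : ℕ) / Real.sqrt d))) *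
              Real.exp ((κ / 2 - δ / 2 * ((D : ℝ) ^ 2 * Real.sqrt d)) / (p : ℕ) / Real.sqrt d)) ^ d) ^ (p - 1)) ^ k := by
  have hδκ : δ * ((D : ℝ) ^ 2 * Real.sqrt d) < κ := by linarith
  have hv2 : v ≤ 2 * w := hv.trans (Nat.le_mul_of_pos_left w two_pos)
  -- (5.11) in cumulants
  have h1 := abs_truncatedExp_kernel_hamiltonian_sub_hatH_le (s := s) (D := D) (ϰ := κ) hK hdiag hK₀ hdec hJ hA0 hA hL hB hδ hδle hδκ w k
  -- Ψ₃-removal at `T_X := hatTuples ∖ Ψ₃cls`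
  have h2 := abs_cumulantOf_kernel_add_psi3_sub_le (s := s) (D := D) (κ := κ) (J := J) (L := L) (w := w) (v := v) (B := B) hK hdiag hK₀ hdec
    hres hδ hδle hA0 hA hv2
    (fun p => hatTuples J p L w B \ B.biUnion (fun m => crossT J p (core L w m) (frame2 L w m) \ crossT J p (core L w m) (frame3 L w v m))) k
  -- the two cumulants of `h2` are `T₀(Ĥ_J)` and `T₀(X)`
  have hhat : truncatedExp (gaussianFieldOfKernel K) (hatH s D κ a L w B) (k + 1) =
      cumulantOf (fun r => ∫ z, ((∑ p ∈ Finset.Icc 1 s, ∑ Δ ∈ hatTuples J p L w B \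
          B.biUnion (fun m => crossT J p (core L w m) (frame2 L w m) \ crossT J p (core L w m) (frame3 L w v m)),
            ∑ n ∈ admissible p D, term κ a z p Δ n) +
          (∑ p ∈ Finset.Icc 1 s, ∑ Δ ∈ B.biUnion (fun m =>
            crossT J p (core L w m) (frame2 L w m) \ crossT J p (core L w m) (frame3 L w v m)),
            ∑ n ∈ admissible p D, term κ a z p Δ n)) ^ r ∂gaussianFieldOfKernel K) (k + 1) := by
    unfold truncatedExp
    congr 1
    funext r
    refine integral_congr_ae (ae_of_all _ fun z => ?_)
    dsimp only
    rw [hatH_eq_X_add_psi3Sum hJ hL z (v := v)]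
  have hX : truncatedExp (gaussianFieldOfKernel K)
        (fun z => hamiltonian s D κ a (corridors L w B) z + ∑ m ∈ B, (psi1 s D κ a L w v m z + psi2 s D κ a L w m z)) (k + 1) =
      cumulantOf (fun r => ∫ z, (∑ p ∈ Finset.Icc 1 s, ∑ Δ ∈ hatTuples J p L w B \
          B.biUnion (fun m => crossT J p (core L w m) (frame2 L w m) \ crossT J p (core L w m) (frame3 L w v m)),
            ∑ n ∈ admissible p D, term κ a z p Δ n) ^ r ∂gaussianFieldOfKernel K) (k + 1) := by
    unfold truncatedExp
    congr 1
    funext r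
    refine integral_congr_ae (ae_of_all _ fun z => ?_)
    dsimp only
    rw [X_eq_tupleSum hJ hL hv z]
  rw [← hhat, ← hX] at h2
  have htri := abs_sub_le (truncatedExp (gaussianFieldOfKernel K) (hamiltonian s D κ a J) (k + 1))
    (truncatedExp (gaussianFieldOfKernel K) (hatH s D κ a L w B) (k + 1))
    (truncatedExp (gaussianFieldOfKernel K)
      (fun z => hamiltonian s D κ a (corridors L w B) z + ∑ m ∈ B, (psi1 s D κ a L w v m z + psi2 s D κ a L w m z)) (k + 1))
  linarith

end HX

/-! ## §2  «H_{Γ̄₁} vs Y» under `𝒩(0,K)` -/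

section HY

variable {s D : ℕ} {κ : ℝ} {a : Coef d} {J : Finset (B1Eq324BenfattoLemma.Site d)} {L w v : ℕ}
  {B : Finset (B1Eq324BenfattoLemma.Site d)}

/-- **«H_{Γ̄₁} vs Y» — (5.33) AND (5.34) INSIDE THE FREE CUMULANTS**: for every order `k+1`,
`|Ê₀^T(H_{Γ̄₁};k+1) − Ê₀^T(Y;k+1)| ≤ [remainder: …Eq534Cumulants at T_X := hatTuplesBar] + [correction: at T_X := hatTuplesBar ∖ corrCls]` — EXTENSIVE
(`∝ |Γ̄₁|` resp. `∝ |B|·L^d`) and exponentially small (`e^{−(c/2)w}`, `e^{−(c/2)v}`). [cite: BenfattoEtAl1978, (5.33)–(5.35) p.159] -/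
theorem abs_truncatedExp_corridorsBar_sub_Y_le (hK : IsPosSemidefKernel K) {c₀ : ℝ≥0} (hdiag : ∀ y, K y y ≤ c₀)
    {K₀ δ₀ : ℝ} (hK₀ : 1 ≤ K₀)
    (hdec : ∀ x y : B1Eq324BenfattoLemma.Site d, |K x y| ≤ K₀ * Real.exp (-(δ₀ * ∑ jj, |((x jj : ℝ) - (y jj : ℝ))|)))
    (hJ : CoefSupportedIn a J) {A : ℝ}
    (hA0 : 0 ≤ A) (hA : ∀ (p : ℕ) (Δ : Fin p → B1Eq324BenfattoLemma.Site d) (n : Fin p → ℕ), |a p Δ n| ≤ A)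
    (hL : 0 < L) (hv : v ≤ w) {δ : ℝ} (hδ : 0 < δ) (hδle : δ ≤ δ₀)
    (hres : 0 < κ / 2 - δ / 2 * ((D : ℝ) ^ 2 * Real.sqrt d)) (k : ℕ) :
    |truncatedExp (gaussianFieldOfKernel K) (hamiltonian s D κ a (corridorsBar L w v B)) (k + 1)
        - truncatedExp (gaussianFieldOfKernel K)
            (fun z => hamiltonian s D κ a (corridors L w B) z + ∑ m ∈ B, (psi1p s D κ a L w v m z + psi2 s D κ a L w m z)) (k + 1)| ≤
      2 ^ (k + 1) * (2 ^ ((k + 1) * D) * 2 ^ 2 ^ ((k + 1) * D) * K₀ ^ ((k + 1) * D)) *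
          (A * Real.exp (δ / 2 * ((D : ℝ) ^ 2 * d)) * Real.exp (-((κ / 2 - δ / 2 * ((D : ℝ) ^ 2 * Real.sqrt d)) / 2 * w)) *
            (corridorsBar L w v B).card * ∑ p ∈ Finset.Icc 1 s, ((admissible p D).card : ℝ) *
              ((2 / (1 - Real.exp (-((κ / 2 - δ / 2 * ((D : ℝ) ^ 2 * Real.sqrt d)) / 2 / (p : ℕ) / Real.sqrt d))) *
                Real.exp ((κ / 2 - δ / 2 * ((D : ℝ) ^ 2 * Real.sqrt d)) / 2 / (p : ℕ) / Real.sqrt d)) ^ d) ^ (p - 1)) *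
          (A * Real.exp (δ / 2 * ((D : ℝ) ^ 2 * d)) *
            (2 / (1 - Real.exp (-(δ / (2 * ((k + 1 : ℕ) : ℝ)) / Real.sqrt d))) * Real.exp (δ / (2 * ((k + 1 : ℕ) : ℝ)) / Real.sqrt d)) ^ d *
            ∑ p ∈ Finset.Icc 1 s, ((admissible p D).card : ℝ) *
              ((2 / (1 - Real.exp (-((κ / 2 - δ / 2 * ((D : ℝ) ^ 2 * Real.sqrt d)) / (p : ℕ) / Real.sqrt d))) *
                Real.exp ((κ / 2 - δ / 2 * ((D : ℝ) ^ 2 * Real.sqrt d)) / (p : ℕ) / Real.sqrt d)) ^ d) ^ (p - 1)) ^ k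
      + 2 ^ (k + 1) * (2 ^ ((k + 1) * D) * 2 ^ 2 ^ ((k + 1) * D) * K₀ ^ ((k + 1) * D)) *
        (B.card * (A * Real.exp (δ / 2 * ((D : ℝ) ^ 2 * d)) * Real.exp (-((κ / 2 - δ / 2 * ((D : ℝ) ^ 2 * Real.sqrt d)) / 2 * v)) *
          (L : ℝ) ^ d * ∑ p ∈ Finset.Icc 1 s, ((admissible p D).card : ℝ) *
            ((2 / (1 - Real.exp (-((κ / 2 - δ / 2 * ((D : ℝ) ^ 2 * Real.sqrt d)) / 2 / (p : ℕ) / Real.sqrt d))) *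
              Real.exp ((κ / 2 - δ / 2 * ((D : ℝ) ^ 2 * Real.sqrt d)) / 2 / (p : ℕ) / Real.sqrt d)) ^ d) ^ (p - 1))) *
        (A * Real.exp (δ / 2 * ((D : ℝ) ^ 2 * d)) *
          (2 / (1 - Real.exp (-(δ / (2 * ((k + 1 : ℕ) : ℝ)) / Real.sqrt d))) * Real.exp (δ / (2 * ((k + 1 : ℕ) : ℝ)) / Real.sqrt d)) ^ d *
          ∑ p ∈ Finset.Icc 1 s, ((admissible p D).card : ℝ) *
            ((2 / (1 - Real.exp (-((κ / 2 - δ / 2 * ((D : ℝ) ^ 2 * Real.sqrt d)) / (p : ℕ) / Real.sqrt d))) *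
              Real.exp ((κ / 2 - δ / 2 * ((D : ℝ) ^ 2 * Real.sqrt d)) / (p : ℕ) / Real.sqrt d)) ^ d) ^ (p - 1)) ^ k := by
  have hv2 : v ≤ 2 * w := hv.trans (Nat.le_mul_of_pos_left w two_pos)
  -- remainder at `T_X := hatTuplesBar`
  have h1 := abs_cumulantOf_kernel_add_remainder_sub_le (s := s) (D := D) (κ := κ) (J := J) (L := L) (w := w) (v := v) (B := B) hK hdiag hK₀
    hdec hL hres hδ hδle hA0 hA (fun p => hatTuplesBar J p L w v B) k
  -- correction at `T_X := hatTuplesBar ∖ corrCls`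
  have h2 := abs_cumulantOf_kernel_add_corr_sub_le (s := s) (D := D) (κ := κ) (J := J) (L := L) (w := w) (v := v) (B := B) hK hdiag hK₀ hdec
    hres hδ hδle hA0 hA hv2
    (fun p => hatTuplesBar J p L w v B \
      B.biUnion (fun m => crossT J p (frame4 L w v m) (frame2 L w m) \ crossT J p (frame4 L w v m) (frame3 L w v m))) k
  -- identify the cumulants
  have hH : truncatedExp (gaussianFieldOfKernel K) (hamiltonian s D κ a (corridorsBar L w v B)) (k + 1) =
      cumulantOf (fun r => ∫ z, ((∑ p ∈ Finset.Icc 1 s, ∑ Δ ∈ hatTuplesBar J p L w v B, ∑ n ∈ admissible p D, term κ a z p Δ n) +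
          (∑ p ∈ Finset.Icc 1 s, ∑ Δ ∈ tuplesIn J p (corridorsBar L w v B) \ hatTuplesBar J p L w v B,
            ∑ n ∈ admissible p D, term κ a z p Δ n)) ^ r ∂gaussianFieldOfKernel K) (k + 1) := by
    unfold truncatedExp
    congr 1
    funext r
    refine integral_congr_ae (ae_of_all _ fun z => ?_)
    dsimp only
    rw [hamiltonian_corridorsBar_eq_tupleSum_add_rem hJ z]
  have hmid : cumulantOf (fun r => ∫ z, ((∑ p ∈ Finset.Icc 1 s, ∑ Δ ∈ hatTuplesBar J p L w v B \
          B.biUnion (fun m => crossT J p (frame4 L w v m) (frame2 L w m) \ crossT J p (frame4 L w v m) (frame3 L w v m)),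
            ∑ n ∈ admissible p D, term κ a z p Δ n) +
          (∑ p ∈ Finset.Icc 1 s, ∑ Δ ∈ B.biUnion (fun m =>
            crossT J p (frame4 L w v m) (frame2 L w m) \ crossT J p (frame4 L w v m) (frame3 L w v m)),
            ∑ n ∈ admissible p D, term κ a z p Δ n)) ^ r ∂gaussianFieldOfKernel K) (k + 1) =
      cumulantOf (fun r => ∫ z, (∑ p ∈ Finset.Icc 1 s, ∑ Δ ∈ hatTuplesBar J p L w v B, ∑ n ∈ admissible p D, term κ a z p Δ n) ^ r
        ∂gaussianFieldOfKernel K) (k + 1) := by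
    congr 1
    funext r
    refine integral_congr_ae (ae_of_all _ fun z => ?_)
    dsimp only
    rw [tupleSum_sdiff_eq (fun p => corrClass_subset_hatTuplesBar p), sub_add_cancel]
  have hY : truncatedExp (gaussianFieldOfKernel K)
        (fun z => hamiltonian s D κ a (corridors L w B) z + ∑ m ∈ B, (psi1p s D κ a L w v m z + psi2 s D κ a L w m z)) (k + 1) =
      cumulantOf (fun r => ∫ z, (∑ p ∈ Finset.Icc 1 s, ∑ Δ ∈ hatTuplesBar J p L w v B \
          B.biUnion (fun m => crossT J p (frame4 L w v m) (frame2 L w m) \ crossT J p (frame4 L w v m) (frame3 L w v m)),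
            ∑ n ∈ admissible p D, term κ a z p Δ n) ^ r ∂gaussianFieldOfKernel K) (k + 1) := by
    unfold truncatedExp
    congr 1
    funext r
    refine integral_congr_ae (ae_of_all _ fun z => ?_)
    dsimp only
    rw [Y_eq_tupleSum hJ hL hv z]
  rw [← hH] at h1
  rw [hmid, ← hY] at h2
  have htri := abs_sub_le (truncatedExp (gaussianFieldOfKernel K) (hamiltonian s D κ a (corridorsBar L w v B)) (k + 1))
    (cumulantOf (fun r => ∫ z, (∑ p ∈ Finset.Icc 1 s, ∑ Δ ∈ hatTuplesBar J p L w v B, ∑ n ∈ admissible p D, term κ a z p Δ n) ^ r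
        ∂gaussianFieldOfKernel K) (k + 1))
    (truncatedExp (gaussianFieldOfKernel K)
      (fun z => hamiltonian s D κ a (corridors L w B) z + ∑ m ∈ B, (psi1p s D κ a L w v m z + psi2 s D κ a L w m z)) (k + 1))
  linarith

end HY

/-! ## §3  «W₂₉ under 𝒩(0,K)»: the within-box (5.29)-type colourings of the reference side -/

section W29

variable {s D : ℕ} {κ : ℝ} {a : Coef d} {J : Finset (B1Eq324BenfattoLemma.Site d)} {L w v : ℕ}
  {B : Finset (B1Eq324BenfattoLemma.Site d)}

/-- **ONE WITHIN-BOX (5.29)-TYPE COLOURING UNDER `𝒩(0,K)` IS SMALL** — Appendix D for the centred kernel field (row 3 of the cluster-side port at `u = 0`): for a colouring `f` of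
`k+1` slots by `Ψ′₁(□), Ψ″₁(□), Ψ₂(□)` using `Ψ″₁` AND `Ψ₂`,
`|𝓔^T_{P̂₀}(f)| ≤ 2^{(k+1)D}2^{2^{(k+1)D}}K₀^{(k+1)D}·e^{−(δ/2)(v+1)}·M̃(□)^{k+1}`, `M̃(□)` the `δ`-inflated mass bound of
`…PerBoxAtPavement.weightedMass_classes_le` — every `Ψ″₁`-tuple meets `□′∖Γ₄(□)`, every `Ψ₂`-tuple lies in `Γ₁(□)∪Γ₂(□)`, at `ℓ¹`-distance `≥ v+1`
(the geometry of `…PerBoxAppD`). [cite: BenfattoEtAl1978, (5.29) p.157, Appendix D p.166] -/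
theorem abs_W29_le (hK : IsPosSemidefKernel K) {c₀ : ℝ≥0} (hdiag : ∀ y, K y y ≤ c₀)
    {K₀ δ₀ : ℝ} (hK₀ : 1 ≤ K₀)
    (hdec : ∀ x y : B1Eq324BenfattoLemma.Site d, |K x y| ≤ K₀ * Real.exp (-(δ₀ * ∑ jj, |((x jj : ℝ) - (y jj : ℝ))|)))
    (hJ : CoefSupportedIn a J) {A : ℝ} (hA0 : 0 ≤ A)
    (hA : ∀ (p : ℕ) (Δ : Fin p → B1Eq324BenfattoLemma.Site d) (n : Fin p → ℕ), |a p Δ n| ≤ A) (hv : v ≤ w)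
    {δ : ℝ} (hδ0 : 0 ≤ δ) (hδle : δ ≤ δ₀) (hres : 0 < κ / 2 - δ / 2 * ((D : ℝ) ^ 2 * Real.sqrt d))
    (m : B1Eq324BenfattoLemma.Site d) (k : ℕ) (f : Fin (k + 1) → Fin 3) (h1 : ∃ j, f j = 1) (h2 : ∃ j, f j = 2) :
    |ursellOf (fun P : Finset (Fin (k + 1)) => ∫ z, ∏ j ∈ P,
        (![fun z => psi1p s D κ a L w v m z, fun z => psi1pp s D κ a L w v m z, fun z => psi2 s D κ a L w m z] (f j)) z
          ∂gaussianFieldOfKernel K) univ| ≤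
      2 ^ ((k + 1) * D) * 2 ^ 2 ^ ((k + 1) * D) * K₀ ^ ((k + 1) * D) *
          Real.exp (-(δ / 2 * ((v : ℝ) + 1))) *
        (A * Real.exp (δ / 2 * ((D : ℝ) ^ 2 * d)) * (L : ℝ) ^ d * ∑ p ∈ Finset.Icc 1 s, ((admissible p D).card : ℝ) *
          ((2 / (1 - Real.exp (-((κ / 2 - δ / 2 * ((D : ℝ) ^ 2 * Real.sqrt d)) / (p : ℕ) / Real.sqrt d))) *
            Real.exp ((κ / 2 - δ / 2 * ((D : ℝ) ^ 2 * Real.sqrt d)) / (p : ℕ) / Real.sqrt d)) ^ d) ^ (p - 1)) ^ (k + 1) := by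
  set T : Fin 3 → (p : ℕ) → Finset (Fin p → J) :=
    ![fun p => tuplesIn J p (frame4 L w v m) ∪ crossT J p (frame4 L w v m) (frame3 L w v m),
      fun p => (tuplesIn J p (core L w m) \ tuplesIn J p (frame4 L w v m)) ∪
        (crossT J p (core L w m) (frame3 L w v m) \ crossT J p (frame4 L w v m) (frame3 L w v m)),
      fun p => crossT J p (frame1 L w m) (frame2 L w m) ∪ tuplesIn J p (frame2 L w m)] with hT
  set Mt : ℝ := A * Real.exp (δ / 2 * ((D : ℝ) ^ 2 * d)) * (L : ℝ) ^ d * ∑ p ∈ Finset.Icc 1 s, ((admissible p D).card : ℝ) *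
      ((2 / (1 - Real.exp (-((κ / 2 - δ / 2 * ((D : ℝ) ^ 2 * Real.sqrt d)) / (p : ℕ) / Real.sqrt d))) *
        Real.exp ((κ / 2 - δ / 2 * ((D : ℝ) ^ 2 * Real.sqrt d)) / (p : ℕ) / Real.sqrt d)) ^ d) ^ (p - 1) with hMt
  -- the slots as tuple-class sums, under `𝒩(0,K)` = the shifted field at `u = 0`
  have hslots : (fun P : Finset (Fin (k + 1)) => ∫ z, ∏ j ∈ P,
        (![fun z => psi1p s D κ a L w v m z, fun z => psi1pp s D κ a L w v m z, fun z => psi2 s D κ a L w m z] (f j)) z ∂gaussianFieldOfKernel K) =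
      fun P : Finset (Fin (k + 1)) => ∫ z, ∏ j ∈ P,
        (∑ p ∈ Finset.Icc 1 s, ∑ Δ ∈ T (f j) p, ∑ n ∈ admissible p D, term κ a z p Δ n)
          ∂((gaussianFieldOfKernel K).map
            fun (ζ : B1Eq324BenfattoLemma.Site d → ℝ) (y : B1Eq324BenfattoLemma.Site d) => (fun _ => (0 : ℝ)) y + ζ y) := by
    funext P
    rw [map_zero_shift_eq K]
    refine integral_congr_ae (ae_of_all _ fun z => ?_)
    exact Finset.prod_congr rfl fun j _ => slot_eq_tupleSum hJ m (f j) z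
  rw [hslots]
  have hK₀1 : (1 : ℝ) ≤ K₀ := hK₀
  have hK₀0 : (0 : ℝ) ≤ K₀ := zero_le_one.trans hK₀1
  obtain ⟨j₁, hj₁⟩ := h1
  obtain ⟨j₂, hj₂⟩ := h2
  have h := abs_ursellOf_tupleSums_shift_le_exp_of_separated
    (σ := Fin (k + 1)) (s := s) (D := D) (ϰ := κ) (a := a) hK (fun _ => (0 : ℝ)) hdiag (fun j => T (f j)) hK₀1 hdec
    (fun j p _ Δ _ i => by rw [abs_zero]; exact hK₀0) hδ0 hδle j₁ j₂
    (shrink L m (2 * w + v) : Set (B1Eq324BenfattoLemma.Site d))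
    (↑(frame1 L w m ∪ frame2 L w m) : Set (B1Eq324BenfattoLemma.Site d)) (ρ₀ := (v : ℝ) + 1)
    (fun p hp Δ hΔ => by
      rw [hj₁] at hΔ
      have hΔ' : Δ ∈ (tuplesIn J p (core L w m) \ tuplesIn J p (frame4 L w v m)) ∪
          (crossT J p (core L w m) (frame3 L w v m) \ crossT J p (frame4 L w v m) (frame3 L w v m)) := hΔ
      obtain ⟨i, hi⟩ := exists_mem_core_sdiff_frame4 hΔ'
      exact ⟨i, Finset.mem_coe.2 hi⟩)
    (fun p hp Δ hΔ => by
      rw [hj₂] at hΔ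
      have hΔ' : Δ ∈ crossT J p (frame1 L w m) (frame2 L w m) ∪ tuplesIn J p (frame2 L w m) := hΔ
      have hp1 : 1 ≤ p := (Finset.mem_Icc.1 hp).1
      refine ⟨⟨0, hp1⟩, Finset.mem_coe.2 ?_⟩
      rcases Finset.mem_union.1 hΔ' with h | h
      · exact (mem_crossT.1 h).1 _
      · exact Finset.mem_union_right _ ((mem_tuplesIn.1 h) _))
    (fun x hx y hy => by
      rw [Finset.mem_coe, ← core_sdiff_frame4] at hx
      exact le_l1_core_sdiff_frame4_of_not_mem_core hx (not_mem_core_of_mem_frame1_union_frame2 (Finset.mem_coe.1 hy)))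
  rw [Fintype.card_fin] at h
  refine h.trans ?_
  have happ : (0 : ℝ) ≤ 2 ^ ((k + 1) * D) * 2 ^ 2 ^ ((k + 1) * D) * K₀ ^ ((k + 1) * D) :=
    mul_nonneg (mul_nonneg (pow_nonneg (by norm_num) _) (pow_nonneg (by norm_num) _)) (pow_nonneg hK₀0 _)
  refine mul_le_mul_of_nonneg_left ?_ (mul_nonneg happ (Real.exp_pos _).le)
  have hmass0 : ∀ c, 0 ≤ ∑ p ∈ Finset.Icc 1 s, ∑ Δ ∈ T c p, ∑ n ∈ admissible p D,
      |a p (fun i => (Δ i : B1Eq324BenfattoLemma.Site d)) n| *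
        Real.exp (-(κ / 2) * connLength fun i => (Δ i : B1Eq324BenfattoLemma.Site d)) *
        Real.exp (δ / 2 * ((D : ℝ) ^ 2 * (Real.sqrt d * connLength (fun i => (Δ i : B1Eq324BenfattoLemma.Site d)) + d))) :=
    fun c => Finset.sum_nonneg fun p _ => Finset.sum_nonneg fun Δ _ => Finset.sum_nonneg fun n _ =>
      mul_nonneg (mul_nonneg (abs_nonneg _) (Real.exp_pos _).le) (Real.exp_pos _).le
  have hMt' : ∀ c, ∑ p ∈ Finset.Icc 1 s, ∑ Δ ∈ T c p, ∑ n ∈ admissible p D,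
      |a p (fun i => (Δ i : B1Eq324BenfattoLemma.Site d)) n| *
        Real.exp (-(κ / 2) * connLength fun i => (Δ i : B1Eq324BenfattoLemma.Site d)) *
        Real.exp (δ / 2 * ((D : ℝ) ^ 2 * (Real.sqrt d * connLength (fun i => (Δ i : B1Eq324BenfattoLemma.Site d)) + d))) ≤ Mt :=
    fun c => weightedMass_classes_le (s := s) (D := D) (κ := κ) (J := J) (L := L) (w := w) (v := v) (m := m) hA0 hres hA hv c
  calc _ ≤ ∏ _j : Fin (k + 1), Mt := Finset.prod_le_prod (fun j _ => hmass0 (f j)) fun j _ => hMt' (f j)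
    _ = Mt ^ (k + 1) := by rw [Finset.prod_const, Finset.card_univ, Fintype.card_fin]

/-- **THE WITHIN-BOX COLOURINGS OF ONE STEP, SUMMED**: `|Σ_{m∈B}Σ_{f uses Ψ″₁ and Ψ₂}𝓔^T_{P̂₀}(f)| ≤ |B|·3^{k+1}·2^{(k+1)D}2^{2^{(k+1)D}}K₀^{(k+1)D}·
e^{−(δ/2)(v+1)}·M̃^{k+1}` (at most `3^{k+1}` colourings per box; `abs_W29_le` each) — the `|Σ_□W₂₉,k(□)|` of `…Sect5Identification`'s `idErr`.
[cite: BenfattoEtAl1978, (5.29) p.157, Appendix D p.166] -/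
theorem abs_sum_W29_le (hK : IsPosSemidefKernel K) {c₀ : ℝ≥0} (hdiag : ∀ y, K y y ≤ c₀)
    {K₀ δ₀ : ℝ} (hK₀ : 1 ≤ K₀)
    (hdec : ∀ x y : B1Eq324BenfattoLemma.Site d, |K x y| ≤ K₀ * Real.exp (-(δ₀ * ∑ jj, |((x jj : ℝ) - (y jj : ℝ))|)))
    (hJ : CoefSupportedIn a J) {A : ℝ} (hA0 : 0 ≤ A)
    (hA : ∀ (p : ℕ) (Δ : Fin p → B1Eq324BenfattoLemma.Site d) (n : Fin p → ℕ), |a p Δ n| ≤ A) (hv : v ≤ w)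
    {δ : ℝ} (hδ0 : 0 ≤ δ) (hδle : δ ≤ δ₀) (hres : 0 < κ / 2 - δ / 2 * ((D : ℝ) ^ 2 * Real.sqrt d))
    (k : ℕ) :
    |∑ m ∈ B, ∑ f ∈ univ.filter (fun f : Fin (k + 1) → Fin 3 => (∃ j, f j = 1) ∧ ∃ j, f j = 2),
        ursellOf (fun P : Finset (Fin (k + 1)) => ∫ z, ∏ j ∈ P,
          (![fun z => psi1p s D κ a L w v m z, fun z => psi1pp s D κ a L w v m z, fun z => psi2 s D κ a L w m z] (f j)) z
            ∂gaussianFieldOfKernel K) univ| ≤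
      B.card * ((3 : ℝ) ^ (k + 1) *
        (2 ^ ((k + 1) * D) * 2 ^ 2 ^ ((k + 1) * D) * K₀ ^ ((k + 1) * D) *
            Real.exp (-(δ / 2 * ((v : ℝ) + 1))) *
          (A * Real.exp (δ / 2 * ((D : ℝ) ^ 2 * d)) * (L : ℝ) ^ d * ∑ p ∈ Finset.Icc 1 s, ((admissible p D).card : ℝ) *
            ((2 / (1 - Real.exp (-((κ / 2 - δ / 2 * ((D : ℝ) ^ 2 * Real.sqrt d)) / (p : ℕ) / Real.sqrt d))) *
              Real.exp ((κ / 2 - δ / 2 * ((D : ℝ) ^ 2 * Real.sqrt d)) / (p : ℕ) / Real.sqrt d)) ^ d) ^ (p - 1)) ^ (k + 1))) := by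
  set bnd : ℝ := 2 ^ ((k + 1) * D) * 2 ^ 2 ^ ((k + 1) * D) * K₀ ^ ((k + 1) * D) *
        Real.exp (-(δ / 2 * ((v : ℝ) + 1))) *
      (A * Real.exp (δ / 2 * ((D : ℝ) ^ 2 * d)) * (L : ℝ) ^ d * ∑ p ∈ Finset.Icc 1 s, ((admissible p D).card : ℝ) *
        ((2 / (1 - Real.exp (-((κ / 2 - δ / 2 * ((D : ℝ) ^ 2 * Real.sqrt d)) / (p : ℕ) / Real.sqrt d))) *
          Real.exp ((κ / 2 - δ / 2 * ((D : ℝ) ^ 2 * Real.sqrt d)) / (p : ℕ) / Real.sqrt d)) ^ d) ^ (p - 1)) ^ (k + 1) with hbnd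
  have hbox : ∀ m ∈ B, |∑ f ∈ univ.filter (fun f : Fin (k + 1) → Fin 3 => (∃ j, f j = 1) ∧ ∃ j, f j = 2),
      ursellOf (fun P : Finset (Fin (k + 1)) => ∫ z, ∏ j ∈ P,
        (![fun z => psi1p s D κ a L w v m z, fun z => psi1pp s D κ a L w v m z, fun z => psi2 s D κ a L w m z] (f j)) z
          ∂gaussianFieldOfKernel K) univ| ≤ (3 : ℝ) ^ (k + 1) * bnd := by
    intro m _
    refine (Finset.abs_sum_le_sum_abs _ _).trans ?_
    have hterm : ∀ f ∈ univ.filter (fun f : Fin (k + 1) → Fin 3 => (∃ j, f j = 1) ∧ ∃ j, f j = 2),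
        |ursellOf (fun P : Finset (Fin (k + 1)) => ∫ z, ∏ j ∈ P,
          (![fun z => psi1p s D κ a L w v m z, fun z => psi1pp s D κ a L w v m z, fun z => psi2 s D κ a L w m z] (f j)) z
            ∂gaussianFieldOfKernel K) univ| ≤ bnd := fun f hf => by
      obtain ⟨h1, h2⟩ := (Finset.mem_filter.1 hf).2
      exact abs_W29_le hK hdiag hK₀ hdec hJ hA0 hA hv hδ0 hδle hres m k f h1 h2
    refine (Finset.sum_le_sum hterm).trans ?_
    rw [Finset.sum_const, nsmul_eq_mul]
    have hbnd0 : 0 ≤ bnd := by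
      rw [hbnd]
      refine mul_nonneg (mul_nonneg (mul_nonneg (mul_nonneg (pow_nonneg (by norm_num) _) (pow_nonneg (by norm_num) _))
        (pow_nonneg (zero_le_one.trans hK₀) _)) (Real.exp_pos _).le) (pow_nonneg ?_ _)
      refine mul_nonneg (mul_nonneg (mul_nonneg hA0 (Real.exp_pos _).le) (pow_nonneg (Nat.cast_nonneg _) _))
        (latticeSumConst_nonneg hres.le)
    have hcard : (((univ.filter (fun f : Fin (k + 1) → Fin 3 => (∃ j, f j = 1) ∧ ∃ j, f j = 2)).card : ℕ) : ℝ) ≤ (3 : ℝ) ^ (k + 1) := by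
      have h := Finset.card_filter_le (univ : Finset (Fin (k + 1) → Fin 3)) (fun f => (∃ j, f j = 1) ∧ ∃ j, f j = 2)
      rw [Finset.card_univ, Fintype.card_fun, Fintype.card_fin, Fintype.card_fin] at h
      exact_mod_cast h
    exact mul_le_mul_of_nonneg_right hcard hbnd0
  refine (Finset.abs_sum_le_sum_abs _ _).trans ((Finset.sum_le_sum hbox).trans ?_)
  rw [Finset.sum_const, nsmul_eq_mul]

end W29

end Literature.MathematicalPhysics.QuantumFieldTheory.Balaban1983to89.B1Eq324BenfattoKernelSect5IdErrBounds

end
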